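import Summits.Parity.GeneralizedHardyLittlewood.Theses.LeeYangFibres
import Summits.Parity.GeneralizedHardyLittlewood.Theorems.LeeYangFibresCellsToRelativeDimOneCounts
import Literature.NumberTheory.Sieve.LinearEquationsInPrimesDimOne
import Literature.NumberTheory.Sieve.LinearEquationsInPrimesOneForm
import HarnessLib

/-!
# Crux `PrimeCellsRelative` (stmt-Parity-14112): the size bound `‖Ψ‖_N ≤ L` is load-bearing

Negative-side support (refuter cdisprove seat). In `PrimeCellsRelative` the threshold `N₀` may
depend on the size bound `L` of the system (`‖Ψ‖_N = ∑|ψ̇ᵢ| + ∑|ψᵢ(0)|/N ≤ L`, so shifts are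
`≤ L N`). Here we record, sorry-free, that this is essential: the variant WITHOUT the size
hypothesis (equivalently: with `N₀` chosen before `L`) — stated inline below, no proposition is
defined under `Summits/` — is false already for one form. Witness at scale `N`: the shifted form
`ψ(n) = n + b_N`, `b_N = (2N+2)! + N + 2`, on the full box `K = [-N, N]`: every value
`ψ(n) = (2N+2)! + (n + N + 2)`, `-N ≤ n ≤ N`, is divisible by `n + N + 2 ∈ [2, 2N+2]`, so the prime
cell is EMPTY, while the model `β_∞ 𝔖 A₁(N)/N = 2N · 1 · A₁(N)/N = 2 A₁(N) ≍ 2N/log N` (prime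
number theorem, tree: `eventually_primeCounting_window`) exceeds the allowance
`ε (2A₁(N) + N/log N)` for `ε = 1/4`.

Moral for provers: uniformity in the shift is available only in the range `|b| ≤ L N` with `N₀`
AFTER `L` (prime-free windows of length `2N + 1` exist at height `(2N+2)!`); the van der
Corput / Gallagher inputs of any proof must see `L`. This file does NOT refute the crux.
-/

noncomputable section

namespace Summit.Parity.GeneralizedHardyLittlewood.Theorems.PrimeCellsRelative.Negative

open scoped BigOperators Topology Classical MeasureTheory
open Filter Set Function MeasureTheory Finset Literature.NumberTheory.Sieve
open Summit.Parity.GeneralizedHardyLittlewood.Theorems.LeeYangFibresCells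
  (card_roughPrimes_le_primeCounting primeCounting_le_card_roughPrimes_add
    eventually_primeCounting_window)

namespace SizeBound

/-- The archimedean factor of the shifted form `n + b`, `b > N`, on the box `[-N, N]` is the full
length `2N` (every point of the box has a positive value). [folklore] -/
theorem archFactor_shift_realBox (N : ℕ) {b : ℤ} (hb : (N : ℤ) < b) :
    archFactor (fun _ : Fin 1 => (⟨fun _ => 1, b⟩ : AffLinForm 1)) (realBox 1 (N : ℝ)) = 2 * N := by
  rw [DimOne.archFactor_eq]
  have hset : {r : ℝ | (fun _ : Fin 1 => r) ∈ realBox 1 (N : ℝ) ∧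
      ∀ _i : Fin 1, 0 < (⟨fun _ => 1, b⟩ : AffLinForm 1).realEval (fun _ => r)} =
        Set.Icc (-(N : ℝ)) N := by
    ext r
    simp only [Set.mem_setOf_eq, realBox, Set.mem_Icc, Pi.le_def, DimOne.realEval_eq,
      Int.cast_one, one_mul, forall_const]
    have hb' : (N : ℝ) < (b : ℝ) := by exact_mod_cast hb
    constructor
    · rintro ⟨⟨h1, h2⟩, -⟩
      exact ⟨h1, h2⟩
    · rintro ⟨h1, h2⟩
      exact ⟨⟨h1, h2⟩, by linarith⟩
  rw [hset, Real.volume_Icc, ENNReal.toReal_ofReal (by linarith [Nat.cast_nonneg (α := ℝ) N])]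
  ring

/-- The singular product of `n + b` is `1` (no local obstruction, `a = 1`). [folklore] -/
theorem singularProduct_shift (b : ℤ) :
    singularProduct (fun _ : Fin 1 => (⟨fun _ => 1, b⟩ : AffLinForm 1)) = 1 := by
  rw [OneForm.singularProduct_eq _ (by simp)]
  simp

/-- No value of `n + (2N+2)! + N + 2`, `-N ≤ n ≤ N`, is a prime: it is divisible by
`n + N + 2 ∈ [2, 2N + 2]`. [folklore] -/
theorem not_prime_shift_value (N : ℕ) {n : ℤ} (hn1 : -(N : ℤ) ≤ n) (hn2 : n ≤ N) :
    ¬ Nat.Prime (n + (((2 * N + 2).factorial : ℕ) + N + 2 : ℤ)).toNat := by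
  obtain ⟨k, hk⟩ : ∃ k : ℕ, (k : ℤ) = n + N + 2 := ⟨(n + N + 2).toNat, Int.toNat_of_nonneg (by omega)⟩
  have hk2 : 2 ≤ k := by omega
  have hkle : k ≤ 2 * N + 2 := by omega
  have hval : (n + (((2 * N + 2).factorial : ℕ) + N + 2 : ℤ)).toNat = (2 * N + 2).factorial + k := by
    have : n + (((2 * N + 2).factorial : ℕ) + N + 2 : ℤ) = (((2 * N + 2).factorial + k : ℕ) : ℤ) := by
      push_cast; omega
    rw [this, Int.toNat_natCast]
  rw [hval]
  intro hp
  have hdvd : k ∣ (2 * N + 2).factorial + k :=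
    (Nat.dvd_add_right (Nat.dvd_factorial (by omega) hkle)).mpr dvd_rfl
  have h1 := (Nat.Prime.eq_one_or_self_of_dvd hp k hdvd)
  have hf : 1 ≤ (2 * N + 2).factorial := Nat.one_le_iff_ne_zero.mpr (Nat.factorial_ne_zero _)
  omega

/-- The arithmetic heart, with the two finsets of the statement abstracted (so that the
decidability instances printed in the route file are met by unification). [folklore] -/
theorem finish {N : ℕ} (hN : 2 ≤ N) {p : (Fin 1 → ℤ) → Prop} {hdec : DecidablePred p} {A : ℕ}
    {S β Z : ℝ}
    (hb : |(#((latticeBox 1 N).filter p) : ℝ) - β * S * ((A : ℝ) / N) ^ 1| ≤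
      1 / 4 * (β * S * ((A : ℝ) / N) ^ 1 + N / Real.log N ^ 1))
    (hnone : ∀ x ∈ latticeBox 1 N, ¬ p x) (hβ : β = 2 * N) (hS : S = 1)
    (hlow : (Nat.primeCounting N : ℝ) ≤ A + Z) (hZ : Z ≤ Real.sqrt N) (hup : (A : ℝ) ≤ Nat.primeCounting N)
    (hwin : ∀ A' : ℝ, (Nat.primeCounting N : ℝ) - Real.sqrt N ≤ A' → A' ≤ Nat.primeCounting N →
      (1 - 1 / 2) * N ≤ A' * Real.log N ∧ A' * Real.log N ≤ (1 + 1 / 2) * N) : False := by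
  have hcount : (#((latticeBox 1 N).filter p) : ℝ) = 0 := by
    rw [Nat.cast_eq_zero, Finset.card_eq_zero, Finset.filter_eq_empty_iff]
    exact hnone
  rw [hcount, hβ, hS, pow_one, pow_one] at hb
  have hN0 : (0 : ℝ) < N := by exact_mod_cast (show 0 < N by omega)
  have hlog : 0 < Real.log N := Real.log_pos (by exact_mod_cast (show 1 < N by omega))
  have h2 : 2 * (N : ℝ) * 1 * ((A : ℝ) / N) = 2 * A := by field_simp
  rw [h2, zero_sub, abs_neg, abs_of_nonneg (by positivity)] at hb
  -- `6 A ≤ N / log N`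
  have h6 : 6 * (A : ℝ) * Real.log N ≤ N := by
    have h' : 6 * (A : ℝ) ≤ N / Real.log N := by linarith
    have := mul_le_mul_of_nonneg_right h' hlog.le
    rwa [div_mul_cancel₀ _ hlog.ne'] at this
  -- the prime number theorem window: `N/2 ≤ A log N`
  have hw := (hwin A (by linarith) hup).1
  nlinarith

end SizeBound

open SizeBound in
/-- **The size bound `‖Ψ‖_N ≤ L` of `PrimeCellsRelative` cannot be dropped** (nor can `N₀` be
chosen before `L`). Without it, at every scale `N ≥ N₀` the one-form system `ψ(n) = n + b_N`,
`b_N = (2N+2)! + N + 2` (non-degenerate; `𝔖 = 1`; `β_∞([-N,N]) = 2N`) has an EMPTY prime cell on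
`K = [-N, N]` (each value is a proper multiple of `n + N + 2 ≥ 2`), whereas the claimed bound with
`ε = 1/4` would force `2 A₁(N) ≤ (2 A₁(N) + N/log N)/4`, i.e. `6 A₁(N) log N ≤ N`, against the prime
number theorem `A₁(N) log N ≥ N/2` (`A₁(N) = π(N) − π(N^{1/u}) ≥ π(N) − √N`). [folklore] -/
theorem primeCellsRelative_false_without_sizeBound :
    ¬ (∀ t : ℕ, 1 ≤ t → ∀ ε : ℝ, 0 < ε → ∃ u : ℕ, 2 ≤ u ∧ ∃ N₀ : ℕ, ∀ N : ℕ, N₀ ≤ N →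
      ∀ Ψ : Fin t → Literature.NumberTheory.Sieve.AffLinForm 1,
        Literature.NumberTheory.Sieve.IsNondegenerateSystem Ψ →
        ∀ K : Set (Fin 1 → ℝ), Convex ℝ K → K ⊆ Literature.NumberTheory.Sieve.realBox 1 N →
          |((((Literature.NumberTheory.Sieve.latticeBox 1 N).filter (fun n =>
              Literature.NumberTheory.Sieve.realPoint n ∈ K ∧ ∀ i, (N : ℝ) ^ ((1 : ℝ) / u) <
                (Nat.minFac ((Ψ i).eval n).toNat : ℝ) ∧
                ArithmeticFunction.cardFactors ((Ψ i).eval n).toNat = 1)).card : ℕ) : ℝ) -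
            Literature.NumberTheory.Sieve.archFactor Ψ K *
              Literature.NumberTheory.Sieve.singularProduct Ψ *
              (((((Finset.Icc 1 N).filter (fun m => (N : ℝ) ^ ((1 : ℝ) / u) < (Nat.minFac m : ℝ) ∧
                ArithmeticFunction.cardFactors m = 1)).card : ℕ) : ℝ) / N) ^ t| ≤
          ε * (Literature.NumberTheory.Sieve.archFactor Ψ K *
              Literature.NumberTheory.Sieve.singularProduct Ψ *
              (((((Finset.Icc 1 N).filter (fun m => (N : ℝ) ^ ((1 : ℝ) / u) < (Nat.minFac m : ℝ) ∧
                ArithmeticFunction.cardFactors m = 1)).card : ℕ) : ℝ) / N) ^ t + N / Real.log N ^ t)) := by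
  intro h
  obtain ⟨u, hu2, N₀, hN₀⟩ := h 1 le_rfl (1 / 4) (by norm_num)
  obtain ⟨N₁, hN₁⟩ := Filter.eventually_atTop.mp
    (eventually_primeCounting_window (η := 1 / 2) (by norm_num))
  -- the scale
  set N : ℕ := max (max N₀ N₁) 2 with hNdef
  have hN₀N : N₀ ≤ N := (le_max_left _ _).trans (le_max_left _ _)
  have hN₁N : N₁ ≤ N := (le_max_right _ _).trans (le_max_left _ _)
  have hN2 : 2 ≤ N := le_max_right _ _
  -- the shift and the system
  set b : ℤ := ((2 * N + 2).factorial : ℕ) + N + 2 with hbdef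
  have hbN : (N : ℤ) < b := by
    have : (1 : ℤ) ≤ ((2 * N + 2).factorial : ℕ) := by exact_mod_cast Nat.factorial_pos _
    omega
  have hb := hN₀ N hN₀N (fun _ => ⟨fun _ => 1, b⟩) ?_ (realBox 1 N) (convex_Icc _ _) subset_rfl
  · refine finish hN2 hb (fun x hx hpx => ?_) (archFactor_shift_realBox N hbN) (singularProduct_shift b)
      (primeCounting_le_card_roughPrimes_add N (Real.rpow_nonneg (Nat.cast_nonneg N) _)) ?_
      (card_roughPrimes_le_primeCounting N _) (hN₁ N hN₁N)
    · -- no prime values on the box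
      obtain ⟨-, hall⟩ := hpx
      obtain ⟨-, hΩ⟩ := hall 0
      have hx0 : -(N : ℤ) ≤ x 0 ∧ x 0 ≤ N := by
        have := Fintype.mem_piFinset.mp hx 0
        simpa using this
      rw [ArithmeticFunction.cardFactors_eq_one_iff_prime, DimOne.eval_eq] at hΩ
      simp only [one_mul] at hΩ
      exact not_prime_shift_value N hx0.1 hx0.2 (by simpa [hbdef] using hΩ)
    · -- `N^{1/u} ≤ √N`
      have hN1 : (1 : ℝ) ≤ (N : ℝ) := by exact_mod_cast (show 1 ≤ N by omega)
      have hu : (1 : ℝ) / u ≤ 1 / 2 := by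
        gcongr
        exact_mod_cast hu2
      calc (N : ℝ) ^ ((1 : ℝ) / u) ≤ (N : ℝ) ^ ((1 : ℝ) / 2) := Real.rpow_le_rpow_of_exponent_le hN1 hu
        _ = Real.sqrt N := by rw [Real.sqrt_eq_rpow]
  · -- non-degenerate
    refine ⟨fun i h0 => ?_, fun i j hij => absurd (Subsingleton.elim i j) hij⟩
    have := congr_fun h0 0
    simp at this

end Summit.Parity.GeneralizedHardyLittlewood.Theorems.PrimeCellsRelative.Negative

end
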